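import Summits.Ventures.WeilGRH.UniformConductorFloorCoprimeSound
import Summits.Ventures.WeilGRH.UniformConductorFloorCoprimeEvenFiveLog8Check
import Summits.Ventures.WeilGRH.UniformConductorFloorCoprimeEvenSevenLog8Check
import Summits.Ventures.WeilGRH.UniformConductorFloorCoprimeEvenTenLog8Check
import Summits.Ventures.WeilGRH.UniformConductorFloorCoprimeEvenFifteenLog8Check
import Summits.Ventures.WeilGRH.UniformConductorFloorCoprimeInputs57Log8
import Summits.Ventures.WeilGRH.UniformConductorFloorPrincipalLog8
import HarnessLib

/-!
# GRH arm (rh-explicit, venture WeilGRH): ★ DIVISIBILITY FLOORS II at the rung `t = (log 8)/2` (levels `5, 7, 10, 15`) and the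
  all-moduli decision at `(log 8)/2` modulo the two moduli `38`, `51`

Cell `rh-explicit`, WEIL TRACK — GRH ARM (weil-grh-1, gen9).  The four EVEN level-`m` joint cell certificates of
`UniformConductorFloorCoprimeData57Log8.lean` (grid `R = 320`, `J = 333`, window `333 log(320/319) = 1.04225 ≥ (log 8)/2`; kernel checks
`…CoprimeEven{Five,Seven,Ten,Fifteen}Log8Check.lean`; inputs `…CoprimeInputs57Log8.lean`) through
`JointCert.weilPositivityOnChar_of_le_of_parts_coprime`, the odd characters being covered by the typed odd floors of the rung
(`weilPositivityOnChar_log8half_of_odd_ge_37`, `…_of_odd_two_dvd_ge_16`, `…_of_odd_three_dvd_ge_21`):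

| `m` | all `χ` mod `q`, `m ∣ q`: stated floor | even certificate |
|---|---|---|
| 5 | 70 | `certEvenDvd5Log8` (budget 4.2382, e^· = 69.29) |
| 7 | 91 | `certEvenDvd7Log8` (budget 4.4667, e^· = 87.07) |
| 10 | 30 | `certEvenDvd10Log8` (budget 3.3433, e^· = 28.31) |
| 15 | 45 | `certEvenDvd15Log8` (budget 3.6394, e^· = 38.07) |

(stated floor = the first multiple of `m` above the method floor `e^budget` whose logarithm has a two-term lower bound in `log 2`, `log 3`).
These close five of the seven moduli `U₈ = {38, 40, 45, 51, 85, 91, 95}` left open by `UniformConductorFloorPrincipalLog8.lean`: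
`85, 95` (level `5`), `91` (level `7`, stated floor exactly `91`), `40` (level `10`), `45` (level `15`, stated floor exactly `45`).
**THEOREM (`forall_weilPositivityOnChar_log8half_iff_of_ne`).**  For every `q ≥ 2` other than `38` and `51`: every Dirichlet character
mod `q` is Weil-positive on `[-(log 8)/2, (log 8)/2]` iff `q ∉ F₈` (the 50-element set of `UniformConductorFloorPrincipalLog8.lean`);
`weilPositivityOnChar_log8half_of_ge_90'`: every character of every modulus `q ≥ 90` (the largest failing modulus is `89`).
The two remaining moduli: `38 = 2·19` (flat threshold of its pattern `37.20`, even Galerkin bottom with 24 modes `37.996` and rising —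
expected FALSE by a margin `≈ 10⁻³`, needs a multi-mode kernel witness) and `51 = 3·17` (flat `49.53`, Galerkin `50.09` — expected TRUE
with margin `≈ 0.017`, needs a direct principal cell at this window); both reduce to the principal character
(`forall_weilPositivityOnChar_log8half_iff_principal_of_mem`).
Honest scope: finite-window statements about all characters of a modulus; nothing here is a step towards GRH for any individual
character; no `ζ` input; standard axioms.

## References

* A. Weil (1952), (11) pp. 261–262 and the «lemme» p. 262 [Weil1952FormulesExplicites]; L. Collatz (1942) / H. Wielandt (1950). [folklore]
-/

noncomputable section

open Real Set
open scoped ArithmeticFunction.vonMangoldt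

namespace Summit.Ventures.WeilGRH

open Literature.NumberTheory.LFunctions

namespace UniformFloor

variable {q : ℕ}

/-! ## The four even floors and their all-parity forms -/

/-- ★ Every EVEN character of every modulus `q ≥ 70` with `5 ∣ q` at the rung `(log 8)/2`. [folklore] -/
theorem weilPositivityOnChar_log8half_of_even_five_dvd_ge_70 (hm : 5 ∣ q) (hq : 70 ≤ q) (χ : DirichletCharacter ℂ q)
    (hpar : charParity χ = 0) : WeilPositivityOnChar χ (Real.log 8 / 2) :=
  certEvenDvd5Log8.weilPositivityOnChar_of_le_of_parts_coprime certEvenDvd5Log8_checkFrame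
    (fun _ hj ↦ certEvenDvd5Log8.cellOKB_of_checkCells certEvenDvd5Log8_checkCells hj) certEvenDvd5Log8_hw psi_even_ge
    (Q₀ := 70) (by norm_num) certEvenDvd5Log8_budget (by omega) hm hq χ hpar (log8half_le_t certEvenDvd5Log8 rfl rfl)

/-- ★★ EVERY Dirichlet character of EVERY modulus `q ≥ 70` with `5 ∣ q` satisfies `WeilPositivityOnChar χ ((log 8)/2)` (odd ones from `37`).
[cite: Weil1952FormulesExplicites, (11) and the «lemme» p. 262] -/
theorem weilPositivityOnChar_log8half_of_five_dvd_ge_70 (hm : 5 ∣ q) (hq : 70 ≤ q) (χ : DirichletCharacter ℂ q) :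
    WeilPositivityOnChar χ (Real.log 8 / 2) := by
  rcases Nat.le_one_iff_eq_zero_or_eq_one.1 (charParity_le_one χ) with h | h
  · exact weilPositivityOnChar_log8half_of_even_five_dvd_ge_70 hm hq χ h
  · exact weilPositivityOnChar_log8half_of_odd_ge_37 (by omega) χ h

/-- ★ Every EVEN character of every modulus `q ≥ 91` with `7 ∣ q` at the rung `(log 8)/2`. [folklore] -/
theorem weilPositivityOnChar_log8half_of_even_seven_dvd_ge_91 (hm : 7 ∣ q) (hq : 91 ≤ q) (χ : DirichletCharacter ℂ q)
    (hpar : charParity χ = 0) : WeilPositivityOnChar χ (Real.log 8 / 2) :=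
  certEvenDvd7Log8.weilPositivityOnChar_of_le_of_parts_coprime certEvenDvd7Log8_checkFrame
    (fun _ hj ↦ certEvenDvd7Log8.cellOKB_of_checkCells certEvenDvd7Log8_checkCells hj) certEvenDvd7Log8_hw psi_even_ge
    (Q₀ := 91) (by norm_num) certEvenDvd7Log8_budget (by omega) hm hq χ hpar (log8half_le_t certEvenDvd7Log8 rfl rfl)

/-- ★★ EVERY Dirichlet character of EVERY modulus `q ≥ 91` with `7 ∣ q` satisfies `WeilPositivityOnChar χ ((log 8)/2)` — in particular
`U_{(log 8)/2}(91)`. [cite: Weil1952FormulesExplicites, (11) and the «lemme» p. 262] -/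
theorem weilPositivityOnChar_log8half_of_seven_dvd_ge_91 (hm : 7 ∣ q) (hq : 91 ≤ q) (χ : DirichletCharacter ℂ q) :
    WeilPositivityOnChar χ (Real.log 8 / 2) := by
  rcases Nat.le_one_iff_eq_zero_or_eq_one.1 (charParity_le_one χ) with h | h
  · exact weilPositivityOnChar_log8half_of_even_seven_dvd_ge_91 hm hq χ h
  · exact weilPositivityOnChar_log8half_of_odd_ge_37 (by omega) χ h

/-- ★ Every EVEN character of every modulus `q ≥ 30` with `10 ∣ q` at the rung `(log 8)/2`. [folklore] -/
theorem weilPositivityOnChar_log8half_of_even_ten_dvd_ge_30 (hm : 10 ∣ q) (hq : 30 ≤ q) (χ : DirichletCharacter ℂ q)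
    (hpar : charParity χ = 0) : WeilPositivityOnChar χ (Real.log 8 / 2) :=
  certEvenDvd10Log8.weilPositivityOnChar_of_le_of_parts_coprime certEvenDvd10Log8_checkFrame
    (fun _ hj ↦ certEvenDvd10Log8.cellOKB_of_checkCells certEvenDvd10Log8_checkCells hj) certEvenDvd10Log8_hw psi_even_ge
    (Q₀ := 30) (by norm_num) certEvenDvd10Log8_budget (by omega) hm hq χ hpar (log8half_le_t certEvenDvd10Log8 rfl rfl)

/-- ★★ EVERY Dirichlet character of EVERY modulus `q ≥ 30` with `10 ∣ q` satisfies `WeilPositivityOnChar χ ((log 8)/2)` (odd ones from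
`2 ∣ q ≥ 16`) — in particular `U_{(log 8)/2}(40)`. [cite: Weil1952FormulesExplicites, (11) and the «lemme» p. 262] -/
theorem weilPositivityOnChar_log8half_of_ten_dvd_ge_30 (hm : 10 ∣ q) (hq : 30 ≤ q) (χ : DirichletCharacter ℂ q) :
    WeilPositivityOnChar χ (Real.log 8 / 2) := by
  rcases Nat.le_one_iff_eq_zero_or_eq_one.1 (charParity_le_one χ) with h | h
  · exact weilPositivityOnChar_log8half_of_even_ten_dvd_ge_30 hm hq χ h
  · exact weilPositivityOnChar_log8half_of_odd_two_dvd_ge_16 (dvd_trans (by norm_num) hm) (by omega) χ h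

/-- ★ Every EVEN character of every modulus `q ≥ 45` with `15 ∣ q` at the rung `(log 8)/2`. [folklore] -/
theorem weilPositivityOnChar_log8half_of_even_fifteen_dvd_ge_45 (hm : 15 ∣ q) (hq : 45 ≤ q) (χ : DirichletCharacter ℂ q)
    (hpar : charParity χ = 0) : WeilPositivityOnChar χ (Real.log 8 / 2) :=
  certEvenDvd15Log8.weilPositivityOnChar_of_le_of_parts_coprime certEvenDvd15Log8_checkFrame
    (fun _ hj ↦ certEvenDvd15Log8.cellOKB_of_checkCells certEvenDvd15Log8_checkCells hj) certEvenDvd15Log8_hw psi_even_ge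
    (Q₀ := 45) (by norm_num) certEvenDvd15Log8_budget (by omega) hm hq χ hpar (log8half_le_t certEvenDvd15Log8 rfl rfl)

/-- ★★ EVERY Dirichlet character of EVERY modulus `q ≥ 45` with `15 ∣ q` satisfies `WeilPositivityOnChar χ ((log 8)/2)` (odd ones from
`3 ∣ q ≥ 21`) — in particular `U_{(log 8)/2}(45)`. [cite: Weil1952FormulesExplicites, (11) and the «lemme» p. 262] -/
theorem weilPositivityOnChar_log8half_of_fifteen_dvd_ge_45 (hm : 15 ∣ q) (hq : 45 ≤ q) (χ : DirichletCharacter ℂ q) :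
    WeilPositivityOnChar χ (Real.log 8 / 2) := by
  rcases Nat.le_one_iff_eq_zero_or_eq_one.1 (charParity_le_one χ) with h | h
  · exact weilPositivityOnChar_log8half_of_even_fifteen_dvd_ge_45 hm hq χ h
  · exact weilPositivityOnChar_log8half_of_odd_three_dvd_ge_21 (dvd_trans (by norm_num) hm) (by omega) χ h

/-- The same on every window `t ≤ (log 8)/2`, level `5`. [folklore] -/
theorem weilPositivityOnChar_of_le_log8half_of_five_dvd_ge_70 (hm : 5 ∣ q) (hq : 70 ≤ q) (χ : DirichletCharacter ℂ q)
    {t : ℝ} (ht : t ≤ Real.log 8 / 2) : WeilPositivityOnChar χ t := fun g hg hsupp ↦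
  weilPositivityOnChar_log8half_of_five_dvd_ge_70 hm hq χ g hg (hsupp.trans (Icc_subset_Icc (by linarith) ht))

/-- The same on every window `t ≤ (log 8)/2`, level `7`. [folklore] -/
theorem weilPositivityOnChar_of_le_log8half_of_seven_dvd_ge_91 (hm : 7 ∣ q) (hq : 91 ≤ q) (χ : DirichletCharacter ℂ q)
    {t : ℝ} (ht : t ≤ Real.log 8 / 2) : WeilPositivityOnChar χ t := fun g hg hsupp ↦
  weilPositivityOnChar_log8half_of_seven_dvd_ge_91 hm hq χ g hg (hsupp.trans (Icc_subset_Icc (by linarith) ht))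

/-! ## All moduli at `(log 8)/2`, modulo `38` and `51` -/

set_option maxRecDepth 100000 in
/-- The five closed members of `U₈` and their floors. [folklore] -/
theorem undecidedLog8_dispatch : ∀ n ∈ ({38, 40, 45, 51, 85, 91, 95} : Finset ℕ),
    n = 38 ∨ n = 51 ∨ (10 ∣ n ∧ 30 ≤ n) ∨ (15 ∣ n ∧ 45 ≤ n) ∨ (5 ∣ n ∧ 70 ≤ n) ∨ (7 ∣ n ∧ 91 ≤ n) := by
  decide

/-- ★ **Positive side, all moduli but two.**  Every Dirichlet character of every modulus `q ≥ 2` outside `F₈`, `q ≠ 38`, `q ≠ 51`,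
is Weil-positive on `[-(log 8)/2, (log 8)/2]`. [cite: Weil1952FormulesExplicites, (11) pp. 261–262 and the «lemme» p. 262] -/
theorem weilPositivityOnChar_log8half_of_not_mem_of_ne (hq2 : 2 ≤ q)
    (hF : q ∉ ({2, 3, 4, 5, 6, 7, 8, 9, 10, 11, 12, 13, 14, 15, 16, 17, 18, 19, 20, 21, 22, 23, 25, 26, 27, 28, 29, 31, 32,
      33, 34, 35, 37, 39, 41, 43, 47, 49, 53, 55, 59, 61, 65, 67, 71, 73, 77, 79, 83, 89} : Finset ℕ))
    (h38 : q ≠ 38) (h51 : q ≠ 51) (χ : DirichletCharacter ℂ q) : WeilPositivityOnChar χ (Real.log 8 / 2) := by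
  by_cases hU : q ∈ ({38, 40, 45, 51, 85, 91, 95} : Finset ℕ)
  · rcases undecidedLog8_dispatch q hU with h | h | ⟨hd, hle⟩ | ⟨hd, hle⟩ | ⟨hd, hle⟩ | ⟨hd, hle⟩
    · exact absurd h h38
    · exact absurd h h51
    · exact weilPositivityOnChar_log8half_of_ten_dvd_ge_30 hd hle χ
    · exact weilPositivityOnChar_log8half_of_fifteen_dvd_ge_45 hd hle χ
    · exact weilPositivityOnChar_log8half_of_five_dvd_ge_70 hd hle χ
    · exact weilPositivityOnChar_log8half_of_seven_dvd_ge_91 hd hle χ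
  · exact weilPositivityOnChar_log8half_of_not_mem hq2 hF hU χ

/-- ★★★ **ALL MODULI at `(log 8)/2`, modulo two.**  For every `q ≥ 2` other than `38` and `51`: every Dirichlet character mod `q`
is Weil-positive on `[-(log 8)/2, (log 8)/2]` iff `q ∉ F₈`; on `F₈` the failing character is the principal one.
[cite: Weil1952FormulesExplicites, (11) pp. 261–262 and the «lemme» p. 262] -/
theorem forall_weilPositivityOnChar_log8half_iff_of_ne (hq2 : 2 ≤ q) (h38 : q ≠ 38) (h51 : q ≠ 51) :
    (∀ χ : DirichletCharacter ℂ q, WeilPositivityOnChar χ (Real.log 8 / 2)) ↔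
      q ∉ ({2, 3, 4, 5, 6, 7, 8, 9, 10, 11, 12, 13, 14, 15, 16, 17, 18, 19, 20, 21, 22, 23, 25, 26, 27, 28, 29, 31, 32,
      33, 34, 35, 37, 39, 41, 43, 47, 49, 53, 55, 59, 61, 65, 67, 71, 73, 77, 79, 83, 89} : Finset ℕ) :=
  ⟨fun h hF ↦ not_weilPositivityOnChar_log8half_principal hF (h 1),
    fun hF χ ↦ weilPositivityOnChar_log8half_of_not_mem_of_ne hq2 hF h38 h51 χ⟩

/-- **The largest failing modulus is `89`, with nothing left open above it**: every character of every modulus `q ≥ 90` is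
Weil-positive on `[-(log 8)/2, (log 8)/2]` (`UniformConductorFloorPrincipalLog8.weilPositivityOnChar_log8half_of_ge_90` needed `q ≠ 91, 95`).
[cite: Weil1952FormulesExplicites, (11) pp. 261–262 and the «lemme» p. 262] -/
theorem weilPositivityOnChar_log8half_of_ge_90' (hq : 90 ≤ q) (χ : DirichletCharacter ℂ q) :
    WeilPositivityOnChar χ (Real.log 8 / 2) := by
  refine weilPositivityOnChar_log8half_of_not_mem_of_ne (by omega) (fun h ↦ ?_) (by omega) (by omega) χ
  simp only [Finset.mem_insert, Finset.mem_singleton] at h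
  omega

/-- The same on every window `t ≤ (log 8)/2`: every character of every modulus `q ≥ 90`. [folklore] -/
theorem weilPositivityOnChar_of_le_log8half_of_ge_90 (hq : 90 ≤ q) (χ : DirichletCharacter ℂ q) {t : ℝ}
    (ht : t ≤ Real.log 8 / 2) : WeilPositivityOnChar χ t := fun g hg hsupp ↦
  weilPositivityOnChar_log8half_of_ge_90' hq χ g hg (hsupp.trans (Icc_subset_Icc (by linarith) ht))

end UniformFloor

end Summit.Ventures.WeilGRH

end
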